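import Summits.ResolutionOfSingularities.ResolutionOfSingularities.Theorems.FrobeniusClosingPatchingRelPerfectMonomialPolyhedraGameDefect
import Summits.ResolutionOfSingularities.ResolutionOfSingularities.Theorems.FrobeniusClosingPatchingRelPerfectMonomialPolyhedraGameCharts
import HarnessLib

/-!
# Crux `PatchingRelPerfect` (stmt-ResolutionOfSingularities-16161), chain w52 — TargetsF3 (m) «M2-strong»,
# COMBINATORIAL HALF, Route F file F4: the CLASS of a non-free index set and its potential `Ψ`

[OURS · L1 W5.2 · background line; res-L1-w52-stub-4 g3 ROUTE-F memo §1 Phase B / §2(c)(d), kernel form;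
fact-free; nothing here is a statement of the manuscript under review]

Fix a state `s`, its free index set `F` and a set `T°` of non-free indices.  The CLASS `cls s F T°` is the set of
NON-principal strata `S` with `S \\ F = T°`; its potential is `psi s F T° = Σ_{S ∈ cls} (minDefect s F S + 1)` where
`minDefect` is the least defect over the Z-class (file F3).  THE PHASE-B STEP (ROUTE-F §2(c)): if `T ∈ cls s F T°`, `f ∈ T ∩ F`, and the Z-class
of `T` has a Z-least member beating some non-Z generator at `f` (no level hypothesis is needed here), then blowing up `J = T° ∪ {f}` (fresh `N`)
gives **`psi (move s J N 0) (insert N F) T° < psi s F T°`** (`psi_move_lt`): the new class consists of untouched old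
members (`f ∉ S`) and of `f`-charts of old members containing `f`, injectively, with `minDefect` not increased
(`defect_chart_le`) and strictly decreased — or the stratum gone — at `T` (`defect_chart_lt`).

## References

* J. Kollár, *Lectures on Resolution of Singularities* (2007), (3.111) Step 3. [Kollar2007]
-/

-- `Summit.<Summit>.<Sub>.Theorems` with `Sub = Summit` (single-conjunct summit, D-0017)
set_option linter.dupNamespace false

namespace Summit.ResolutionOfSingularities.ResolutionOfSingularities.Theorems

namespace PolyhedraGame

open Finset

/-! ## The defect is monotone in the Z-member; the minimal defect -/

section MinDefect

variable {s : State} {F : Finset ℕ}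

/-- [OURS] The defect is monotone in the reference vector on `T ∩ F`. -/
theorem defect_mono {T : Finset ℕ} {ζ μ : ℕ →₀ ℕ} (h : ∀ g ∈ T ∩ F, ζ g ≤ μ g) :
    defect s F T ζ ≤ defect s F T μ :=
  Finset.sum_le_sum fun _ _ => Finset.sum_le_sum fun g hg => Nat.sub_le_sub_right (h g hg) _

variable (s F) in
/-- [OURS · W5.2 Route F] The MINIMAL DEFECT of `T`: the least defect over the Z-class (`0` if the Z-class is empty,
which does not happen in the free game). -/
noncomputable def minDefect (T : Finset ℕ) : ℕ :=
  if h : (Z s F T).Nonempty then ((Z s F T).image (defect s F T)).min' (h.image _) else 0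

/-- [OURS] The minimal defect is below the defect of every Z-member. -/
theorem minDefect_le_defect {T : Finset ℕ} {ζ : ℕ →₀ ℕ} (hζ : ζ ∈ Z s F T) :
    minDefect s F T ≤ defect s F T ζ := by
  rw [minDefect, dif_pos ⟨ζ, hζ⟩]
  exact Finset.min'_le _ _ (Finset.mem_image_of_mem _ hζ)

/-- [OURS] The minimal defect is attained. -/
theorem exists_defect_eq_minDefect {T : Finset ℕ} (hne : (Z s F T).Nonempty) :
    ∃ ζ ∈ Z s F T, defect s F T ζ = minDefect s F T := by
  rw [minDefect, dif_pos hne]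
  obtain ⟨ζ, hζ, h⟩ := Finset.mem_image.mp (Finset.min'_mem ((Z s F T).image (defect s F T)) (hne.image _))
  exact ⟨ζ, hζ, h⟩

/-- [OURS] A Z-least member realises the minimal defect. -/
theorem IsZLeast.defect_eq_minDefect {T : Finset ℕ} {ζ : ℕ →₀ ℕ} (hζ : IsZLeast s F T ζ) :
    defect s F T ζ = minDefect s F T := by
  refine le_antisymm ?_ (minDefect_le_defect hζ.1)
  obtain ⟨μ, hμ, hμeq⟩ := exists_defect_eq_minDefect ⟨ζ, hζ.1⟩
  rw [← hμeq]
  exact defect_mono (hζ.2 μ hμ)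

end MinDefect

/-! ## Strata untouched by a move keep their Z-class and defects -/

section Untouched

variable {s : State} {F : Finset ℕ} {J : Finset ℕ} {N c : ℕ}

/-- [OURS] **The Z-class after a move, at an index set whose `F`-free part consists of old indices, is the image
of the old Z-class of any index set with the same `F`-free part.** -/
theorem Z_move_eq_image (hN : N ∉ s.B) {S' T : Finset ℕ} (hS' : S' \ insert N F = T \ F) (hT : T \ F ⊆ s.B) :
    Z (move s J N c) (insert N F) S' = (Z s F T).image (moveExp J N c) := by
  classical
  ext α'
  rw [mem_Z_iff, hS', Finset.mem_image]
  constructor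
  · rintro ⟨hα', hmin⟩
    obtain ⟨α, hα, rfl⟩ := Finset.mem_image.mp hα'
    refine ⟨α, mem_Z_iff.mpr ⟨hα, fun β hβ i hi => ?_⟩, rfl⟩
    have := hmin (moveExp J N c β) (Finset.mem_image_of_mem _ hβ) i hi
    rwa [moveExp_apply_old hN (hT hi), moveExp_apply_old hN (hT hi)] at this
  · rintro ⟨α, hα, rfl⟩
    obtain ⟨hαA, hmin⟩ := mem_Z_iff.mp hα
    refine ⟨Finset.mem_image_of_mem _ hαA, fun β' hβ' i hi => ?_⟩
    obtain ⟨β, hβ, rfl⟩ := Finset.mem_image.mp hβ'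
    rw [moveExp_apply_old hN (hT hi), moveExp_apply_old hN (hT hi)]
    exact hmin β hβ i hi

/-- [OURS] **At a stratum avoiding the exceptional index the defects are unchanged by the move.** -/
theorem defect_move_of_not_mem (hs : s.WF) (hN : N ∉ s.B) {S : Finset ℕ} (hNS : N ∉ S) (hS : S ⊆ s.B)
    (ζ : ℕ →₀ ℕ) :
    defect (move s J N c) (insert N F) S (moveExp J N c ζ) = defect s F S ζ := by
  classical
  have hSd : S \ insert N F = S \ F := by
    ext i
    simp only [Finset.mem_sdiff, Finset.mem_insert, not_or]
    exact ⟨fun ⟨h1, _, h3⟩ => ⟨h1, h3⟩, fun ⟨h1, h3⟩ => ⟨h1, fun h => hNS (h ▸ h1), h3⟩⟩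
  have hSi : S ∩ insert N F = S ∩ F := by
    ext i
    simp only [Finset.mem_inter, Finset.mem_insert]
    exact ⟨fun ⟨h1, h2⟩ => ⟨h1, h2.resolve_left fun h => hNS (h ▸ h1)⟩, fun ⟨h1, h2⟩ => ⟨h1, Or.inr h2⟩⟩
  have hZ := Z_move_eq_image (J := J) (c := c) hN hSd ((Finset.sdiff_subset).trans hS)
  rw [defect, defect, hZ, hSi]
  have hsd : (move s J N c).A \ (Z s F S).image (moveExp J N c) = (s.A \ Z s F S).image (moveExp J N c) := by
    show s.A.image _ \ _ = _
    rw [Finset.image_sdiff_of_injOn (moveExp_injOn hs hN) (fun α hα => mem_A_of_mem_Z hα)]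
  rw [hsd, Finset.sum_image fun α hα β hβ h =>
    moveExp_injOn hs hN (Finset.mem_sdiff.mp hα).1 (Finset.mem_sdiff.mp hβ).1 h]
  refine Finset.sum_congr rfl fun α _ => Finset.sum_congr rfl fun g hg => ?_
  have hgB : g ∈ s.B := hS (Finset.mem_inter.mp hg).1
  rw [moveExp_apply_old hN hgB, moveExp_apply_old hN hgB]

/-- [OURS] Hence the minimal defect at such a stratum is unchanged. -/
theorem minDefect_move_of_not_mem (hs : s.WF) (hN : N ∉ s.B) {S : Finset ℕ} (hNS : N ∉ S) (hS : S ⊆ s.B) :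
    minDefect (move s J N c) (insert N F) S = minDefect s F S := by
  classical
  have hSd : S \ insert N F = S \ F := by
    ext i
    simp only [Finset.mem_sdiff, Finset.mem_insert, not_or]
    exact ⟨fun ⟨h1, _, h3⟩ => ⟨h1, h3⟩, fun ⟨h1, h3⟩ => ⟨h1, fun h => hNS (h ▸ h1), h3⟩⟩
  have hZ := Z_move_eq_image (J := J) (c := c) hN hSd ((Finset.sdiff_subset).trans hS)
  by_cases hne : (Z s F S).Nonempty
  · refine le_antisymm ?_ ?_
    · obtain ⟨ζ, hζ, hζeq⟩ := exists_defect_eq_minDefect hne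
      rw [← hζeq, ← defect_move_of_not_mem hs hN hNS hS ζ]
      exact minDefect_le_defect (hZ ▸ Finset.mem_image_of_mem _ hζ)
    · have hne' : (Z (move s J N c) (insert N F) S).Nonempty := by rw [hZ]; exact hne.image _
      obtain ⟨ζ', hζ', hζ'eq⟩ := exists_defect_eq_minDefect hne'
      rw [hZ] at hζ'
      obtain ⟨ζ, hζ, rfl⟩ := Finset.mem_image.mp hζ'
      rw [← hζ'eq, defect_move_of_not_mem hs hN hNS hS ζ]
      exact minDefect_le_defect hζ
  · have hne' : ¬ (Z (move s J N c) (insert N F) S).Nonempty := by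
      rw [hZ, Finset.image_nonempty]; exact hne
    rw [minDefect, dif_neg hne', minDefect, dif_neg hne]

end Untouched

/-! ## The minimal defect on the `f`-chart -/

section ChartMin

variable {s : State} {F T : Finset ℕ} {f N : ℕ}

/-- [OURS] **The minimal defect of the `f`-chart is at most that of its parent** (any parent with a non-empty
Z-class). -/
theorem minDefect_chart_le (hs : s.WF) (hN : N ∉ s.B) (hf : f ∈ F) (hfT : f ∈ T) (hT : T ⊆ s.B)
    (hne : (Z s F T).Nonempty) :
    minDefect (move s (insert f (T \ F)) N 0) (insert N F) (insert N (T.erase f)) ≤ minDefect s F T := by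
  obtain ⟨ζ, hζ, hζeq⟩ := exists_defect_eq_minDefect hne
  rw [← hζeq]
  refine (minDefect_le_defect ?_).trans (defect_chart_le hs hN hf hfT hT hζ)
  rw [Z_chart hN hf hT]
  exact Finset.mem_image_of_mem _ hζ

/-- [OURS] **… and strictly smaller when a Z-least member of the parent is beaten at `f` by a non-Z generator.** -/
theorem minDefect_chart_lt (hs : s.WF) (hN : N ∉ s.B) (hf : f ∈ F) (hfT : f ∈ T) (hT : T ⊆ s.B)
    {ζ : ℕ →₀ ℕ} (hζ : IsZLeast s F T ζ) {α₀ : ℕ →₀ ℕ} (hα₀ : α₀ ∈ s.A) (hα₀Z : α₀ ∉ Z s F T)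
    (hviol : α₀ f < ζ f) :
    minDefect (move s (insert f (T \ F)) N 0) (insert N F) (insert N (T.erase f)) < minDefect s F T := by
  rw [← hζ.defect_eq_minDefect]
  refine (minDefect_le_defect ?_).trans_lt (defect_chart_lt hs hN hf hfT hT hζ.1 hα₀ hα₀Z hviol)
  rw [Z_chart hN hf hT]
  exact Finset.mem_image_of_mem _ hζ.1

end ChartMin

/-! ## The class of a non-free index set and its potential -/

section ClassPotential

variable (s : State) (F : Finset ℕ)

/-- [OURS · W5.2 Route F] The CLASS of the non-free index set `T°`: the non-principal strata whose `F`-free part is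
`T°`. -/
noncomputable def cls (T₀ : Finset ℕ) : Finset (Finset ℕ) := by
  classical exact s.Str.filter fun S => S \ F = T₀ ∧ ¬ PrincipalAt s S

/-- [OURS · W5.2 Route F] The Phase-B POTENTIAL of the class: `Σ_{S ∈ cls} (minDefect S + 1)`. -/
noncomputable def psi (T₀ : Finset ℕ) : ℕ := ∑ S ∈ cls s F T₀, (minDefect s F S + 1)

variable {s F}

/-- [OURS] Membership in the class. -/
theorem mem_cls_iff {T₀ S : Finset ℕ} : S ∈ cls s F T₀ ↔ S ∈ s.Str ∧ S \ F = T₀ ∧ ¬ PrincipalAt s S := by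
  classical
  simp only [cls, Finset.mem_filter]

/-- [OURS] The potential vanishes iff the class is empty, i.e. iff every stratum with `F`-free part `T°` is
principal. -/
theorem psi_eq_zero_iff {T₀ : Finset ℕ} : psi s F T₀ = 0 ↔ ∀ S ∈ s.Str, S \ F = T₀ → PrincipalAt s S := by
  rw [psi, Finset.sum_eq_zero_iff]
  constructor
  · intro h S hS hSF
    by_contra hnp
    have := h S (mem_cls_iff.mpr ⟨hS, hSF, hnp⟩)
    omega
  · intro h S hS
    obtain ⟨hS', hSF, hnp⟩ := mem_cls_iff.mp hS
    exact absurd (h S hS' hSF) hnp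

variable {T₀ T : Finset ℕ} {f N : ℕ}

/-- [OURS] The `f`-chart of a stratum `S₀ ∋ f`: `f` replaced by the exceptional index `N`. -/
def chartOf (f N : ℕ) (S₀ : Finset ℕ) : Finset ℕ := insert N (S₀.erase f)

/-- [OURS] `chartOf` is injective on sets containing `f` and avoiding `N`. -/
theorem chartOf_injOn {P : Finset (Finset ℕ)} (hP : ∀ S₀ ∈ P, f ∈ S₀ ∧ N ∉ S₀) :
    Set.InjOn (chartOf f N) P := by
  intro S₀ h₀ S₁ h₁ h
  have key : ∀ S ∈ P, insert f ((chartOf f N S).erase N) = S := by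
    intro S hS
    obtain ⟨hfS, hNS⟩ := hP S hS
    rw [chartOf, Finset.erase_insert (fun h => hNS (Finset.mem_of_mem_erase h)), Finset.insert_erase hfS]
  rw [← key S₀ h₀, ← key S₁ h₁, h]

/-- [OURS] **The parent of a new class member through the exceptional index.**  After the move with centre
`J = insert f T°` (fresh `N`), a non-principal stratum `S ∋ N` of the moved state with `S \ (insert N F) = T°` is
the `f`-chart of the old stratum `S₀ = insert f (S.erase N)`, which contains `f`, has `F`-free part `T°` (`f ∈ F`)
and is non-principal. -/
theorem exists_parent_of_mem_cls (hs : s.WF) (hN : N ∉ s.B) (hf : f ∈ F) (hfB : f ∈ s.B) {S : Finset ℕ}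
    (hS : S ∈ cls (move s (insert f T₀) N 0) (insert N F) T₀) (hNS : N ∈ S) :
    ∃ S₀ ∈ cls s F T₀, f ∈ S₀ ∧ N ∉ S₀ ∧ chartOf f N S₀ = S := by
  obtain ⟨hSstr, hSF, hSnp⟩ := mem_cls_iff.mp hS
  rcases mem_moveStrata_iff.mp hSstr with ⟨hold, -⟩ | ⟨U, hU, hJU, hUJ, rfl⟩
  · exact absurd (hs.str_subset S hold hNS) hN
  · have hNU : N ∉ U := fun h => hN (hs.str_subset U hU h)
    have hUF : U \ F = T₀ := by
      rw [← hSF]; ext i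
      simp only [Finset.mem_sdiff, Finset.mem_insert, not_or]
      constructor
      · rintro ⟨h1, h2⟩; exact ⟨Or.inr h1, fun h => hNU (h ▸ h1), h2⟩
      · rintro ⟨h1 | h1, h2, h3⟩
        · exact absurd h1 h2
        · exact ⟨h1, h3⟩
    have hT₀U : T₀ ⊆ U := fun i hi => by
      have : i ∈ U \ F := hUF.symm ▸ hi
      exact (Finset.mem_sdiff.mp this).1
    have hfU : f ∉ U := fun h => hJU (Finset.insert_subset h hT₀U)
    have hUJ' : U ∪ insert f T₀ = insert f U := by
      rw [Finset.union_insert, Finset.union_eq_left.mpr hT₀U]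
    refine ⟨insert f U, mem_cls_iff.mpr ⟨hUJ' ▸ hUJ, ?_, fun hp => hSnp ?_⟩, Finset.mem_insert_self _ _,
      fun h => ?_, ?_⟩
    · rw [← hUF]; ext i
      simp only [Finset.mem_sdiff, Finset.mem_insert]
      constructor
      · rintro ⟨h1 | h1, h2⟩
        · exact absurd (h1 ▸ hf) h2
        · exact ⟨h1, h2⟩
      · rintro ⟨h1, h2⟩; exact ⟨Or.inr h1, h2⟩
    · exact principalAt_chart hs hN hNU (hUJ'.symm ▸ hp)
    · rcases Finset.mem_insert.mp h with h | h
      · exact hN (h ▸ hfB)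
      · exact hNU h
    · rw [chartOf, Finset.erase_insert hfU]

/-- [OURS] A class member avoiding the exceptional index is an old class member not containing `f`, with the same
minimal defect. -/
theorem mem_cls_of_not_mem (hs : s.WF) (hN : N ∉ s.B) {S : Finset ℕ}
    (hS : S ∈ cls (move s (insert f T₀) N 0) (insert N F) T₀) (hNS : N ∉ S) :
    S ∈ cls s F T₀ ∧ f ∉ S ∧ minDefect (move s (insert f T₀) N 0) (insert N F) S = minDefect s F S := by
  obtain ⟨hSstr, hSF, hSnp⟩ := mem_cls_iff.mp hS
  obtain ⟨hold, hJS⟩ := mem_str_of_mem_move_str_of_not_mem hSstr hNS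
  have hSF' : S \ F = T₀ := by
    rw [← hSF]; ext i
    simp only [Finset.mem_sdiff, Finset.mem_insert, not_or]
    exact ⟨fun ⟨h1, h3⟩ => ⟨h1, fun h => hNS (h ▸ h1), h3⟩, fun ⟨h1, _, h3⟩ => ⟨h1, h3⟩⟩
  have hT₀S : T₀ ⊆ S := fun i hi => by
    have : i ∈ S \ F := hSF'.symm ▸ hi
    exact (Finset.mem_sdiff.mp this).1
  refine ⟨mem_cls_iff.mpr ⟨hold, hSF', fun hp => hSnp ((principalAt_move_iff hNS).mpr hp)⟩,
    fun h => hJS (Finset.insert_subset h hT₀S), minDefect_move_of_not_mem hs hN hNS (hs.str_subset S hold)⟩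

/-- [OURS] **THE PHASE-B STEP (ROUTE-F §2(c)): the potential of the class drops.**  Hypotheses: the state is
well formed with free set `F` (every `F`-free stratum principal), `T` is in the class, `f ∈ T ∩ F`, `ζ` is Z-least at `T` and is
beaten at `f` by the non-Z generator `α₀`; the centre is `J = insert f T°` and `N` is fresh. -/
theorem psi_move_lt (hs : s.WF) (hF : Free s F) (hT : T ∈ cls s F T₀) (hfT : f ∈ T) (hf : f ∈ F)
    {ζ : ℕ →₀ ℕ} (hζ : IsZLeast s F T ζ) {α₀ : ℕ →₀ ℕ} (hα₀ : α₀ ∈ s.A) (hα₀Z : α₀ ∉ Z s F T)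
    (hviol : α₀ f < ζ f) (hN : N ∉ s.B) :
    psi (move s (insert f T₀) N 0) (insert N F) T₀ < psi s F T₀ := by
  classical
  obtain ⟨hTstr, hTF, hTnp⟩ := mem_cls_iff.mp hT
  have hfB : f ∈ s.B := hF.subset hf
  set s' := move s (insert f T₀) N 0 with hs'
  set F' := insert N F with hF'
  set g : Finset ℕ → ℕ := fun S => minDefect s F S + 1 with hg
  set g' : Finset ℕ → ℕ := fun S => minDefect s' F' S + 1 with hg'
  -- old class split by `f ∈ S`, new class split by `N ∈ S`
  set P := (cls s F T₀).filter fun S => f ∈ S with hP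
  set Q := P.filter fun S₀ => chartOf f N S₀ ∈ cls s' F' T₀ with hQ
  have hPfn : ∀ S₀ ∈ P, f ∈ S₀ ∧ N ∉ S₀ := fun S₀ h₀ => by
    obtain ⟨h₀, hf₀⟩ := Finset.mem_filter.mp h₀
    exact ⟨hf₀, fun h => hN (hs.str_subset S₀ (mem_cls_iff.mp h₀).1 h)⟩
  -- (1) new members avoiding `N` form a subset of the old members avoiding `f`, with the same `g`
  have h1 : ∑ S ∈ (cls s' F' T₀).filter (fun S => N ∉ S), g' S ≤
      ∑ S ∈ (cls s F T₀).filter (fun S => f ∉ S), g S := by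
    have hsub : (cls s' F' T₀).filter (fun S => N ∉ S) ⊆ (cls s F T₀).filter (fun S => f ∉ S) := by
      intro S hS
      obtain ⟨hS, hNS⟩ := Finset.mem_filter.mp hS
      obtain ⟨h, hfS, -⟩ := mem_cls_of_not_mem hs hN hS hNS
      exact Finset.mem_filter.mpr ⟨h, hfS⟩
    calc ∑ S ∈ (cls s' F' T₀).filter (fun S => N ∉ S), g' S
        = ∑ S ∈ (cls s' F' T₀).filter (fun S => N ∉ S), g S := by
          refine Finset.sum_congr rfl fun S hS => ?_
          obtain ⟨hS, hNS⟩ := Finset.mem_filter.mp hS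
          show minDefect s' F' S + 1 = minDefect s F S + 1
          rw [(mem_cls_of_not_mem hs hN hS hNS).2.2]
      _ ≤ ∑ S ∈ (cls s F T₀).filter (fun S => f ∉ S), g S := Finset.sum_le_sum_of_subset hsub
  -- (2) new members through `N` are the charts of the members of `Q`
  have h2eq : (cls s' F' T₀).filter (fun S => N ∈ S) = Q.image (chartOf f N) := by
    ext S
    simp only [Finset.mem_filter, Finset.mem_image, hQ, hP]
    constructor
    · rintro ⟨hS, hNS⟩
      obtain ⟨S₀, h₀, hf₀, -, hch⟩ := exists_parent_of_mem_cls hs hN hf hfB hS hNS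
      exact ⟨S₀, ⟨⟨h₀, hf₀⟩, hch.symm ▸ hS⟩, hch⟩
    · rintro ⟨S₀, ⟨⟨-, -⟩, hch⟩, rfl⟩
      exact ⟨hch, Finset.mem_insert_self _ _⟩
  have hQP : Q ⊆ P := Finset.filter_subset _ _
  have h2 : ∑ S ∈ (cls s' F' T₀).filter (fun S => N ∈ S), g' S = ∑ S₀ ∈ Q, g' (chartOf f N S₀) := by
    rw [h2eq, Finset.sum_image ((chartOf_injOn hPfn).mono (fun _ h => hQP h))]
  -- termwise comparison on `Q`: chart ≤ parent, strict at `T`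
  have hterm : ∀ S₀ ∈ Q, g' (chartOf f N S₀) ≤ g S₀ := by
    intro S₀ h₀
    obtain ⟨h₀P, -⟩ := Finset.mem_filter.mp h₀
    obtain ⟨h₀c, hf₀⟩ := Finset.mem_filter.mp h₀P
    obtain ⟨h₀str, h₀F, -⟩ := mem_cls_iff.mp h₀c
    have hne : (Z s F S₀).Nonempty := Z_nonempty_iff.mpr (hF.principalAt _
      (hs.str_down S₀ h₀str _ Finset.sdiff_subset) Finset.sdiff_disjoint)
    have := minDefect_chart_le (N := N) hs hN hf hf₀ (hs.str_subset S₀ h₀str) hne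
    rw [h₀F] at this
    simp only [hg, hg', chartOf]
    exact Nat.add_le_add_right this 1
  have hTP : T ∈ P := Finset.mem_filter.mpr ⟨hT, hfT⟩
  have hTlt : g' (chartOf f N T) < g T := by
    have := minDefect_chart_lt (N := N) hs hN hf hfT (hs.str_subset T hTstr) hζ hα₀ hα₀Z hviol
    rw [hTF] at this
    simp only [hg, hg', chartOf]
    exact Nat.add_lt_add_right this 1
  have h3 : ∑ S₀ ∈ Q, g' (chartOf f N S₀) < ∑ S₀ ∈ P, g S₀ := by
    by_cases hTQ : T ∈ Q
    · exact (Finset.sum_lt_sum hterm ⟨T, hTQ, hTlt⟩).trans_le (Finset.sum_le_sum_of_subset hQP)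
    · have hQ' : Q ⊆ P.erase T := fun S₀ h₀ =>
        Finset.mem_erase.mpr ⟨fun h => hTQ (h ▸ h₀), hQP h₀⟩
      calc ∑ S₀ ∈ Q, g' (chartOf f N S₀) ≤ ∑ S₀ ∈ Q, g S₀ := Finset.sum_le_sum hterm
        _ ≤ ∑ S₀ ∈ P.erase T, g S₀ := Finset.sum_le_sum_of_subset hQ'
        _ < ∑ S₀ ∈ P, g S₀ := by
          rw [← Finset.add_sum_erase P g hTP]
          have : 1 ≤ g T := Nat.le_add_left 1 _
          omega
  -- assemble
  calc psi s' F' T₀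
      = ∑ S ∈ (cls s' F' T₀).filter (fun S => N ∈ S), g' S +
          ∑ S ∈ (cls s' F' T₀).filter (fun S => N ∉ S), g' S := by
        rw [psi, ← Finset.sum_filter_add_sum_filter_not (cls s' F' T₀) (fun S => N ∈ S)]
    _ < ∑ S₀ ∈ P, g S₀ + ∑ S ∈ (cls s F T₀).filter (fun S => f ∉ S), g S := by
        rw [h2]; exact Nat.add_lt_add_of_lt_of_le h3 h1
    _ = psi s F T₀ := by
        rw [psi, hP, ← Finset.sum_filter_add_sum_filter_not (cls s F T₀) (fun S => f ∈ S)]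

end ClassPotential

end PolyhedraGame

end Summit.ResolutionOfSingularities.ResolutionOfSingularities.Theorems
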